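import Summits.BirchSwinnertonDyer.BirchSwinnertonDyer.Theorems.ClassRecordThreeShimuraKolyvaginImageInputs
import Summits.BirchSwinnertonDyer.BirchSwinnertonDyer.Theorems.ErratumRoadFiveShimuraKolyvaginOrderBoundInertShiftCebotarev
import HarnessLib

/-!
# The torsion-leaf consumers of the ORDER machine, image-free: no `Γ_K`-fixed point in `E[p^j]` and
# injectivity of `H¹(K, E[p^M]) → H¹(K, E[p^{M+k}])` from `E(K)[p] = 0` alone; at `p = 3` from `Irr`
# (cell `bsd-stepL`, seat `bsd-stepL-shim3b` g4; helper for the record item stmt-BirchSwinnertonDyer-19616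
# `ShimuraKolyvaginOrderBoundAtThree` and for seat shim3a's conductor-keyed order machine)

HONEST FRAMING (programme file §HONESTY, verbatim): «no tranche here proves BSD; ARM L moves the
LITERAL column of an r ≤ 1 census into the kernel-proved-modulo-named-print column; ARM P changes what
«named print» is worth. The residue (4.31 %) and every SUMMIT-BEARING rung (S0–S3) stay theorem-bound
and are staffed by the 22 routes, not by this programme.» THEOREMS ONLY (no definition, no named fact,
no `sorry`); nothing here is a BSD class theorem; no census label moves; item 19616 stays ASIDE.

## What this file does

Besides the Čebotarev step (`exists_kolyvaginPrime_gt_pow[_kernel]`, re-keyed on the image inputs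
in `…CebotarevOfImage` / `…CebotarevKernelOfImage`), the conductor-keyed ORDER machine of seat
shim3a g2 (`…ShimuraKolyvaginOrderBoundAtThreeSurjOrderCTValue` l.165, `…OrderCebShift` l.97,
`…OrderAtPrime` l.240) reads `hρ : ρ̄_{E,p}` onto through exactly two more lemmas, both of which use
it only to get the torsion leaf `E(K)[p] = 0` (`torsionBy_eq_bot_of_isImaginaryQuadratic … hρ`):

* `KolyvaginDescent.forall_smul_eq_imp_eq_zero_of_surjective` /
  `Theorems.geomTorsion_pow_eq_zero_of_fixed` — `E(K̄)[p^j]` has no non-zero `Γ_K`-fixed point;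
* `Theorems.torsionH1OfDvd_pow_injective` — `ι_* : H¹(K, E[p^M]) → H¹(K, E[p^{M+k}])` is injective.

This file states both with the HYPOTHESIS `E(K)[p] = 0` in place of `hρ` (proofs = the tree's /
seat shim-p1's, verbatim after the first line):

* `geomTorsion_pow_eq_zero_of_fixed_of_torsionBy_eq_bot`,
  `torsionH1OfDvd_pow_injective_of_torsionBy_eq_bot` — any number field `K`, any prime `p`;
* `geomTorsion_three_pow_eq_zero_of_fixed_of_irr`, `torsionH1OfDvd_three_pow_injective_of_irr` —
  at `p = 3` for `K` imaginary quadratic and EVERY `E[3]` irreducible (seat g3's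
  `ShimuraKolyvaginImageOverK.torsionBy_three_eq_bot_of_irr_of_isImaginaryQuadratic`).

With `…CebotarevOfImage`, `…CebotarevKernelOfImage`, `…ImageInputs` and seat g3's files, EVERY
`hρ`-consumer of the order machine at `p = 3` now has an `Irr`-only twin in the tree (recipe in
the docstring of `…CebotarevKernelOfImage`).  NOT claimed: any re-keying of the machine itself
(owner: seat shim3a), any Kolyvagin class or order bound.

References: [GrossLMS1991] §4 Lemma 4.3, §2; [GreenbergLNM1716] §2 (p. 63); [McCallumLMS1991] §4.
-/

set_option autoImplicit false
set_option linter.dupNamespace false -- the Theorems namespace repeats the summit name, as in every sibling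

noncomputable section

open scoped Classical Pointwise

open WeierstrassCurve NumberField IsDedekindDomain Field
  Literature.NumberTheory.EllipticCurves Literature.NumberTheory.GaloisRepresentations
  Summit.BirchSwinnertonDyer.Rank1Residual

universe u

namespace Summit.BirchSwinnertonDyer.BirchSwinnertonDyer.Theorems.ShimuraKolyvaginFixedOfTorsion

section General

variable {K : Type u} [Field K] [NumberField K] (W : WeierstrassCurve ℚ)

/-- **No non-zero `Γ_K`-fixed point in `E(K̄)[p^j]` when `E(K)[p] = 0`** (`K` any number field,
`p` any prime): a fixed point is `K`-rational (Galois descent,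
`exists_toGeomPoints_eq_of_forall_smul_eq`) and `p`-power torsion, hence `0` by induction on the
exponent.  Seat shim-p1's `Theorems.geomTorsion_pow_eq_zero_of_fixed` (= the tree's
`KolyvaginDescent.forall_smul_eq_imp_eq_zero_of_surjective`) with `ρ̄_{E,p}` onto replaced by its
only use, the torsion leaf. [cite: GrossLMS1991, §4 Lemma 4.3] -/
theorem geomTorsion_pow_eq_zero_of_fixed_of_torsionBy_eq_bot {p : ℕ}
    (hbot : AddSubgroup.torsionBy (W.baseChange K).toAffine.Point (p : ℤ) = ⊥) (j : ℕ)
    (P : geomTorsion (W.baseChange K) ((p ^ j : ℕ) : ℤ))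
    (hP : ∀ σ : absoluteGaloisGroup K, σ • P = P) : P = 0 := by
  haveI : PerfectField K := PerfectField.ofCharZero
  have hA : ∀ a : (W.baseChange K).toAffine.Point, p • a = 0 → a = 0 := fun a ha ↦ by
    have : a ∈ AddSubgroup.torsionBy (W.baseChange K).toAffine.Point (p : ℤ) := by
      rw [mem_torsionBy_iff, natCast_zsmul]; exact ha
    rw [hbot] at this
    exact this
  have hpow : ∀ (j : ℕ) (R : (W.baseChange K).toAffine.Point), p ^ j • R = 0 → R = 0 := by
    intro j
    induction j with
    | zero => intro R h; simpa using h
    | succ j ih =>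
      intro R h
      exact ih R (hA _ (by rw [← mul_nsmul, ← pow_succ]; exact h))
  have hfix : ∀ σ : absoluteGaloisGroup K, σ • (P : geomPoints (W.baseChange K)) = P :=
    fun σ ↦ congrArg Subtype.val (hP σ)
  obtain ⟨R, hR⟩ := exists_toGeomPoints_eq_of_forall_smul_eq (W.baseChange K) hfix
  have hRj : p ^ j • R = 0 := by
    apply toGeomPoints_injective (W.baseChange K)
    rw [map_nsmul, hR, map_zero, ← natCast_zsmul]
    push_cast
    exact (mem_geomTorsion_iff _ _ _).mp P.2
  apply Subtype.ext
  rw [ZeroMemClass.coe_zero, ← hR, hpow j R hRj, map_zero]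

/-- **`ι_* : H¹(K, E[p^M]) → H¹(K, E[p^{M+k}])` is injective when `E(K)[p] = 0`** (`K` any number
field): the kernel is `E[p^{M+k}]^{Γ_K}/p^M` (Kummer) and `E[p^{M+k}]^{Γ_K} = 0`
(`geomTorsion_pow_eq_zero_of_fixed_of_torsionBy_eq_bot`); x11b3's
`Levels.map_one_injective_of_forall_fixed_eq_zero` through `map_torsionInclusion_one_apply`.  Seat
shim-p1's `Theorems.torsionH1OfDvd_pow_injective` with `ρ̄_{E,p}` onto replaced by the torsion leaf.
[cite: GreenbergLNM1716, §2 p. 63] -/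
theorem torsionH1OfDvd_pow_injective_of_torsionBy_eq_bot [W.IsElliptic] {p : ℕ}
    (hbot : AddSubgroup.torsionBy (W.baseChange K).toAffine.Point (p : ℤ) = ⊥) (M k : ℕ) :
    Function.Injective
      (torsionH1OfDvd (W.baseChange K) (natCast_pow_dvd_natCast_pow_add p M k)) := by
  haveI : (W.baseChange K).IsElliptic := inferInstanceAs (W.map (algebraMap ℚ K)).IsElliptic
  have key : Function.Injective
      (galoisCohomology.map ((W.baseChange K).torsionInclusion
        (natCast_pow_dvd_natCast_pow_add p M k)) 1) := by
    refine X11b.Levels.map_one_injective_of_forall_fixed_eq_zero (n := p ^ M) ?_ ?_ ?_ ?_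
    · intro b hb
      have hb' : ((p ^ M : ℕ) : ℤ) • (b : geomPoints (W.baseChange K)) = 0 := by
        rw [natCast_zsmul, ← AddSubmonoidClass.coe_nsmul, hb, ZeroMemClass.coe_zero]
      exact ⟨⟨(b : geomPoints (W.baseChange K)), (mem_geomTorsion_iff _ _ _).2 hb'⟩,
        Subtype.ext rfl⟩
    · intro a a' h
      exact Subtype.ext (congrArg
        (fun P : geomTorsion (W.baseChange K) ((p ^ (M + k) : ℕ) : ℤ) ↦
          (P : geomPoints (W.baseChange K))) h)
    · intro a
      apply Subtype.ext
      rw [AddSubmonoidClass.coe_nsmul, ZeroMemClass.coe_zero, ← natCast_zsmul]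
      exact (mem_geomTorsion_iff _ _ _).1 a.2
    · intro b hb
      exact geomTorsion_pow_eq_zero_of_fixed_of_torsionBy_eq_bot W hbot (M + k) b fun σ ↦ by
        have h := hb σ
        rwa [torsionGaloisModule_apply_apply] at h
  intro x y hxy
  apply key
  rw [map_torsionInclusion_one_apply, map_torsionInclusion_one_apply]
  exact hxy

end General

/-! ## At `p = 3` for every irreducible `E[3]` and every imaginary quadratic `K` -/

section Three

variable (K : Type u) [Field K] [NumberField K] (W : WeierstrassCurve ℚ) [W.IsElliptic]

/-- **No non-zero `Γ_K`-fixed point in `E(K̄)[3^j]`** for `K` imaginary quadratic and `E[3]`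
irreducible (any image): seat g3's torsion leaf
`torsionBy_three_eq_bot_of_irr_of_isImaginaryQuadratic` fed into
`geomTorsion_pow_eq_zero_of_fixed_of_torsionBy_eq_bot`. [cite: GrossLMS1991, §4 Lemma 4.3] -/
theorem geomTorsion_three_pow_eq_zero_of_fixed_of_irr (hK : IsImaginaryQuadratic K)
    (hirr : W.HasIrreducibleModPGaloisRep 3) (j : ℕ)
    (P : geomTorsion (W.baseChange K) ((3 ^ j : ℕ) : ℤ))
    (hP : ∀ σ : absoluteGaloisGroup K, σ • P = P) : P = 0 := by
  haveI : Fact (Nat.Prime 3) := ⟨Nat.prime_three⟩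
  exact geomTorsion_pow_eq_zero_of_fixed_of_torsionBy_eq_bot W
    (ShimuraKolyvaginImageOverK.torsionBy_three_eq_bot_of_irr_of_isImaginaryQuadratic W K hK hirr)
    j P hP

/-- **`ι_* : H¹(K, E[3^M]) → H¹(K, E[3^{M+k}])` is injective** for `K` imaginary quadratic and
`E[3]` irreducible (any image). [cite: GreenbergLNM1716, §2 p. 63] -/
theorem torsionH1OfDvd_three_pow_injective_of_irr (hK : IsImaginaryQuadratic K)
    (hirr : W.HasIrreducibleModPGaloisRep 3) (M k : ℕ) :
    Function.Injective
      (torsionH1OfDvd (W.baseChange K) (natCast_pow_dvd_natCast_pow_add 3 M k)) := by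
  haveI : Fact (Nat.Prime 3) := ⟨Nat.prime_three⟩
  exact torsionH1OfDvd_pow_injective_of_torsionBy_eq_bot W
    (ShimuraKolyvaginImageOverK.torsionBy_three_eq_bot_of_irr_of_isImaginaryQuadratic W K hK hirr)
    M k

end Three

end Summit.BirchSwinnertonDyer.BirchSwinnertonDyer.Theorems.ShimuraKolyvaginFixedOfTorsion

end
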